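import Literature.Barriers.AnomalousDissipation.ShearFlowViscositySelectionLimitSteps
import Literature.Analysis.FluidPDE.LerayHopfTimeSliceTorus
import Literature.Analysis.FunctionSpaces.TorusScalarTrigPoly
import HarnessLib

/-!
# Bardos–Titi–Wiedemann 2012, Thm. 5 — proof architecture, part 4: the heat-flow limit of the
first component (discharge of `BardosTitiWiedemann2012_thm5_heatLimit`)

Fourth companion to `Literature/Barriers/AnomalousDissipation/ShearFlowViscositySelection.lean`
(Bardos–Titi–Wiedemann, C. R. Math. 350 (2012), Thm. 5). `ShearFlowViscositySelectionLimitSteps`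
proved the subsequential vanishing-viscosity limit `BardosTitiWiedemann2012_thm5_subseqLimit`
from four named facts; this file **proves** one of them,
`BardosTitiWiedemann2012_thm5_heatLimit`: for Leray–Hopf solutions of the two-and-a-half-
dimensional form `u^ν = (a^ν(t,x₂), 0, c^ν(t,x₁,x₂))` with shear datum `(v₁(x₂), 0, v₃(x₁,x₂))`,
the first components converge to `v₁` strongly in `L²((0,T) × T³)` as `ν → 0` — the printed
sentence "the first equation is simply the one-dimensional heat equation with initial data
`v₁(x₂)`, whose solution obviously converges to the time-independent function `v₁(x₂)` strongly
in `L²(T×[0,T])`, as the viscosity tends to zero" (op. cit., proof of Thm. 5).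

## The proof

No separate existence or uniqueness theory for the heat equation is invoked: the heat flow is
read off the Leray–Hopf weak formulation itself, mode by mode.

1. `eq_mul_exp_of_forall_eq_sub_mul_setIntegral` — the integrated linear decay equation
   `φ(t) = c - μ∫₀ᵗ φ` on `(0,T]` (for an integrable `φ`) forces `φ(t) = c e^{-μt}` (fundamental
   theorem of calculus for the continuous primitive and uniqueness for Lipschitz ODEs,
   Mathlib's `ODE_solution_unique_of_mem_Icc_right`).
2. `lerayHopf_integral_inner_eq_exp_mul` — **orthogonal eigenmodes of a Leray–Hopf solution
   decay like the Stokes flow**: if `Ψ` is a smooth divergence-free field with `ΔΨ = -λΨ` and the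
   convective pairing `∫ ⟪u(s), (u(s)·∇)Ψ⟫` vanishes for a.e. `s`, then
   `⟨u(t), Ψ⟩ = e^{-νλt} ⟨u₀, Ψ⟩` for every `t ∈ (0,T]` (any dimension; the time-sliced weak
   formulation `Torus.IsLerayHopfOn.integral_inner_eq_add_setIntegral`, Temam 1984, Ch. III
   (1.25), is exactly the Volterra equation of step 1).
3. `convect_shearField_realTrigPoly_eq_zero`, `mFourierCoeff_shear_first_eq` — for the shear
   form `U = (a(x₂), 0, c(x₁,x₂))` and the axial vector modes `Ψ = Re (e_k(x) w) ê₁`,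
   `k = (0,k₂,0)` (paper coordinates; indices `0,1,2` in Lean), the convective derivative
   `(U·∇)Ψ` vanishes *identically*, so step 2 gives the heat-flow coefficients
   `𝓕(a(t,·))(k) = e^{-4π²|k|²νt} 𝓕v₁(k)` for every `t ∈ (0,T]` and every `k ∈ ℤ³` (off the
   axis both sides vanish, the functions not depending on `x₁, x₃`).
4. `hasSum_sq_heatDefect` — Parseval on `T³` (Grafakos 2014, Prop. 3.2.7 (3)):
   `∫|a(t,·) - v₁|² = ∑_k (1 - e^{-4π²|k|²νt})² |𝓕v₁(k)|²`;
   `tendsto_tsum_heatDefect` — `∑_k (1 - e^{-4π²|k|²ν_jT})² |𝓕v₁(k)|² → 0` as `ν_j → 0`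
   (Tannery's theorem, dominated by the summable `|𝓕v₁(k)|²`).
5. `BardosTitiWiedemann2012_thm5_heatLimit_holds` — `∫₀ᵀ∫|a_j - v₁|² ≤ T ∑_k (…)² |𝓕v₁(k)|² → 0`.

## Mathlib / tree search

Mathlib (this pin) has the Fourier basis of `L²(UnitAddTorus d)` (`UnitAddTorus.mFourierBasis`,
`hasSum_sq_mFourierCoeff`), Tannery's theorem (`tendsto_tsum_of_dominated_convergence`) and ODE
uniqueness (`ODE_solution_unique_of_mem_Icc_right`), but no heat equation on the torus and no
weak-solution theory (searched `heat`, `NavierStokes` in Mathlib: none). The tree supplies the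
time-sliced weak formulation of Leray–Hopf solutions (`FluidPDE/LerayHopfTimeSliceTorus`), the
real vector modes and their calculus (`FunctionSpaces/TorusFourierModes`, `TorusTrigPoly`), the
axis-invariance of Fourier coefficients (`FunctionSpaces/TorusAxisAverage`) and the real-scalar
Parseval identity (`FunctionSpaces/TorusScalarTrigPoly`); no statement identifying a component
of a weak Navier–Stokes solution with a heat flow existed (searched `heat`, `mFourierCoeff` with
`IsLerayHopfOn`: none).

## References

* C. Bardos, E. S. Titi, E. Wiedemann, *The vanishing viscosity as a selection principle for
  the Euler equations: the case of 3D shear flow*, C. R. Math. Acad. Sci. Paris 350 (2012)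
  757–760 (arXiv:1208.2352), Thm. 5 and its proof (`BardosTitiWiedemann2012`).
* R. Temam, *Navier–Stokes Equations* (3rd ed., North-Holland 1984), Ch. III §1.1,
  (1.22)–(1.25), Lemma 1.1 (time-sliced weak formulation) (`Temam1984`).
* L. Grafakos, *Classical Fourier Analysis*, 3rd ed., GTM 249 (2014), Prop. 3.2.7 (3)
  (Parseval on `T^d`) (`Grafakos2014`).
-/

open MeasureTheory Set Filter Topology Function UnitAddTorus Complex
open scoped ENNReal NNReal InnerProductSpace RealInnerProductSpace

noncomputable section

namespace Literature.Barriers.AnomalousDissipation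

/-! ## A linear Volterra equation: `φ(t) = c - μ ∫₀ᵗ φ` forces `φ(t) = c e^{-μt}` -/

/-- **The integrated linear decay equation has only the exponential solution.** If `φ` is
integrable on `(0,T)` and `φ(t) = c - μ ∫_{(0,t]} φ` for every `t ∈ (0,T]`, then
`φ(t) = c e^{-μt}` for every `t ∈ (0,T]`: the primitive `G(t) = ∫₀ᵗ φ` is continuous, solves
`G' = c - μ G`, `G(0) = 0` on `[0,T]` (fundamental theorem of calculus, the integrand
`c - μ G` being continuous), hence equals `(c/μ)(1 - e^{-μt})` by uniqueness for Lipschitz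
ODEs (Mathlib's `ODE_solution_unique_of_mem_Icc_right`). [folklore] -/
theorem eq_mul_exp_of_forall_eq_sub_mul_setIntegral {T c μ : ℝ} {φ : ℝ → ℝ}
    (hφ : IntegrableOn φ (Ioo 0 T))
    (h : ∀ t ∈ Ioc 0 T, φ t = c - μ * ∫ s in Ioc 0 t, φ s) :
    ∀ t ∈ Ioc 0 T, φ t = c * Real.exp (-(μ * t)) := by
  intro t ht
  have hT : 0 < T := ht.1.trans_le ht.2
  rcases eq_or_ne μ 0 with rfl | hμ
  · simpa using h t ht
  -- the primitive
  have hφ' : IntegrableOn φ (Icc 0 T) :=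
    (integrableOn_Icc_iff_integrableOn_Ioo (μ := (volume : Measure ℝ))).2 hφ
  set G : ℝ → ℝ := fun τ => ∫ s in (0 : ℝ)..τ, φ s with hG
  have hGc : ContinuousOn G (Icc 0 T) := by
    have := intervalIntegral.continuousOn_primitive_interval (μ := (volume : Measure ℝ))
      (a := 0) (b := T) (f := φ) (by rwa [uIcc_of_le hT.le])
    rwa [uIcc_of_le hT.le] at this
  have hGeq : ∀ τ ∈ Icc 0 T, G τ = ∫ s in Ioc 0 τ, φ s := fun τ hτ =>
    intervalIntegral.integral_of_le hτ.1
  have hφG : ∀ τ ∈ Ioc 0 T, φ τ = c - μ * G τ := fun τ hτ => by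
    rw [hGeq τ ⟨hτ.1.le, hτ.2⟩]; exact h τ hτ
  -- the continuous integrand `g = c - μ G`
  set g : ℝ → ℝ := fun τ => c - μ * G τ with hg
  have hgc : ContinuousOn g (Icc 0 T) := continuousOn_const.sub (hGc.const_smul μ)
  have hGg : ∀ τ ∈ Icc 0 T, G τ = ∫ s in (0 : ℝ)..τ, g s := by
    intro τ hτ
    rw [hGeq τ hτ, ← intervalIntegral.integral_of_le hτ.1, intervalIntegral.integral_of_le hτ.1,
      intervalIntegral.integral_of_le hτ.1]
    refine setIntegral_congr_fun measurableSet_Ioc fun s hs => ?_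
    exact hφG s ⟨hs.1, hs.2.trans hτ.2⟩
  -- `G' = g` within `[0,T]`, hence within `[t, ∞)` for `t < T`
  have hGderiv : ∀ τ ∈ Ico 0 T, HasDerivWithinAt G (g τ) (Ici τ) τ := by
    intro τ hτ
    have hτ' : τ ∈ Icc 0 T := Ico_subset_Icc_self hτ
    haveI : Fact (τ ∈ Icc 0 T) := ⟨hτ'⟩
    have hint : IntervalIntegrable g volume 0 τ :=
      (hgc.mono (by rw [uIcc_of_le hτ'.1]; exact Icc_subset_Icc le_rfl hτ'.2)).intervalIntegrable
    have h1 : HasDerivWithinAt (fun u => ∫ s in (0 : ℝ)..u, g s) (g τ) (Icc 0 T) τ :=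
      intervalIntegral.integral_hasDerivWithinAt_right hint
        (hgc.stronglyMeasurableAtFilter_nhdsWithin measurableSet_Icc τ) (hgc τ hτ')
    have h2 : HasDerivWithinAt G (g τ) (Icc 0 T) τ :=
      h1.congr (fun y hy => hGg y hy) (hGg τ hτ')
    exact h2.mono_of_mem_nhdsWithin (Icc_mem_nhdsGE_of_mem hτ)
  -- the explicit solution
  set Gs : ℝ → ℝ := fun τ => c / μ * (1 - Real.exp (-(μ * τ))) with hGs
  have hGs_deriv : ∀ τ, HasDerivAt Gs (c - μ * Gs τ) τ := by
    intro τ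
    have h1 : HasDerivAt (fun τ => -(μ * τ)) (-μ) τ := by
      have e : (fun τ : ℝ => -(μ * τ)) = fun τ => -μ * τ := by funext; ring
      rw [e]
      simpa using (hasDerivAt_id τ).const_mul (-μ)
    have h2 : HasDerivAt (fun τ => Real.exp (-(μ * τ))) (Real.exp (-(μ * τ)) * -μ) τ :=
      h1.exp
    have h3 : HasDerivAt Gs (c / μ * (0 - Real.exp (-(μ * τ)) * -μ)) τ :=
      ((hasDerivAt_const τ (1 : ℝ)).sub h2).const_mul (c / μ)
    convert h3 using 1
    simp only [hGs]
    field_simp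
    ring
  have hv : ∀ τ ∈ Ico (0 : ℝ) T, LipschitzOnWith ‖μ‖₊ ((fun (_ : ℝ) (x : ℝ) => c - μ * x) τ) univ := by
    intro τ _
    refine (LipschitzWith.of_dist_le_mul fun x y => ?_).lipschitzOnWith
    rw [dist_eq_norm, dist_eq_norm, coe_nnnorm]
    have : c - μ * x - (c - μ * y) = -(μ * (x - y)) := by ring
    rw [this, norm_neg, norm_mul]
  have huniq := ODE_solution_unique_of_mem_Icc_right (v := fun (_ : ℝ) (x : ℝ) => c - μ * x)
    (s := fun _ => univ) (K := ‖μ‖₊) (f := G) (g := Gs) (a := 0) (b := T) hv hGc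
    (fun τ hτ => hGderiv τ hτ) (fun _ _ => mem_univ _)
    (fun τ _ => (hGs_deriv τ).continuousAt.continuousWithinAt)
    (fun τ _ => (hGs_deriv τ).hasDerivWithinAt) (fun _ _ => mem_univ _)
    (by simp [hG, hGs])
  have hGt : G t = Gs t := huniq ⟨ht.1.le, ht.2⟩
  rw [hφG t ht, hGt, hGs]
  field_simp
  ring


/-! ## Linear modes of Leray–Hopf solutions decay like the Stokes flow when the nonlinearity is
orthogonal to them -/

section LinearMode

variable {d : Type*} [Fintype d] [DecidableEq d]

/-- **Exponential decay of an orthogonal eigenmode of a Leray–Hopf solution.** Let `u` be an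
unforced Leray–Hopf weak solution on `T^d × [0,T)` with viscosity `ν` and datum `u₀`, and let
`Ψ` be a smooth divergence-free field with `ΔΨ = -λΨ` such that the convective pairing
`∫ ⟪u(s), (u(s)·∇)Ψ⟫` vanishes for a.e. `s ∈ (0,T)`. Then for every `t ∈ (0,T]`,
`⟨u(t), Ψ⟩ = e^{-νλt} ⟨u₀, Ψ⟩`: the time-sliced weak formulation (Temam 1984, Ch. III (1.25);
`Torus.IsLerayHopfOn.integral_inner_eq_add_setIntegral`) reads
`⟨u(t),Ψ⟩ = ⟨u₀,Ψ⟩ - νλ ∫₀ᵗ ⟨u(s),Ψ⟩ ds`, a linear Volterra equation with the single solution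
`e^{-νλt}⟨u₀,Ψ⟩` (`eq_mul_exp_of_forall_eq_sub_mul_setIntegral`). This is the mechanism by which
the shear components of the two-and-a-half-dimensional Navier–Stokes solutions of
Bardos–Titi–Wiedemann 2012 (proof of Thm. 5) are heat flows. [folklore] -/
theorem lerayHopf_integral_inner_eq_exp_mul {T ν : ℝ} (hT : 0 < T)
    {u₀ : UnitAddTorus d → EuclideanSpace ℝ d} {u : ℝ → UnitAddTorus d → EuclideanSpace ℝ d}
    (hu : Literature.Analysis.FluidPDE.Torus.IsLerayHopfOn T ν 0 u₀ u)
    {Ψ : UnitAddTorus d → EuclideanSpace ℝ d} (hΨ : Literature.Analysis.FunctionSpaces.Torus.IsSmooth Ψ)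
    (hΨdiv : Literature.Analysis.FunctionSpaces.Torus.IsDivFree Ψ) {lam : ℝ}
    (hΔ : ∀ x, Literature.Analysis.FunctionSpaces.Torus.laplacian Ψ x = (-lam) • Ψ x)
    (horth : ∀ᵐ s ∂(volume.restrict (Ioo 0 T)),
      ∫ x, ⟪u s x, Literature.Analysis.FunctionSpaces.Torus.convect (u s) Ψ x⟫ = 0)
    {t : ℝ} (ht : t ∈ Ioc 0 T) :
    ∫ x, ⟪u t x, Ψ x⟫ = Real.exp (-(ν * lam * t)) * ∫ x, ⟪u₀ x, Ψ x⟫ := by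
  -- the zero force is admissible
  have hfm : AEStronglyMeasurable
      (Literature.Analysis.FunctionSpaces.Torus.stLift (0 : ℝ → UnitAddTorus d → EuclideanSpace ℝ d))
      (volume.restrict (Ioo 0 T ×ˢ univ)) :=
    aestronglyMeasurable_const (b := (0 : EuclideanSpace ℝ d))
  have hf₂ : ∫⁻ t in Ioo 0 T, ∫⁻ x, ‖(0 : ℝ → UnitAddTorus d → EuclideanSpace ℝ d) t x‖ₑ ^ 2 < ⊤ := by
    simp
  -- the flux against `Ψ` on a slice `s` with vanishing convective pairing
  set φ : ℝ → ℝ := fun s => ∫ x, ⟪u s x, Ψ x⟫ with hφ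
  have hflux : ∀ᵐ s ∂(volume.restrict (Ioo 0 T)),
      ∫ x, (⟪u s x, Literature.Analysis.FunctionSpaces.Torus.convect (u s) Ψ x⟫ +
        ν * ⟪u s x, Literature.Analysis.FunctionSpaces.Torus.laplacian Ψ x⟫ +
        ⟪(0 : ℝ → UnitAddTorus d → EuclideanSpace ℝ d) s x, Ψ x⟫) = -(ν * lam) * φ s := by
    filter_upwards [horth, ae_restrict_mem measurableSet_Ioo] with s hs hsI
    have hmem : MemLp (u s) 2 volume := hu.memLp s (Ioo_subset_Icc_self hsI)
    have i1 : Integrable (fun x => ⟪u s x, Literature.Analysis.FunctionSpaces.Torus.convect (u s) Ψ x⟫) volume :=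
      Literature.Analysis.FluidPDE.Torus.integrable_inner_convect_self hmem hΨ
    have i2 : Integrable (fun x => ⟪u s x, Ψ x⟫) volume :=
      Literature.Analysis.FunctionSpaces.Torus.integrable_inner_of_continuous
        (hmem.integrable one_le_two) hΨ.continuous
    have hpt : (fun x => ⟪u s x, Literature.Analysis.FunctionSpaces.Torus.convect (u s) Ψ x⟫ +
        ν * ⟪u s x, Literature.Analysis.FunctionSpaces.Torus.laplacian Ψ x⟫ +
        ⟪(0 : ℝ → UnitAddTorus d → EuclideanSpace ℝ d) s x, Ψ x⟫) =
        fun x => ⟪u s x, Literature.Analysis.FunctionSpaces.Torus.convect (u s) Ψ x⟫ +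
          (-(ν * lam)) * ⟪u s x, Ψ x⟫ := by
      funext x
      rw [hΔ x, Pi.zero_apply, Pi.zero_apply, inner_zero_left, add_zero, real_inner_smul_right]
      ring
    rw [hpt, integral_add i1 (i2.const_mul _), integral_const_mul, hs, zero_add]
  -- the Volterra equation for `φ`
  have hvolterra : ∀ τ ∈ Ioc 0 T, φ τ = (∫ x, ⟪u₀ x, Ψ x⟫) - (ν * lam) * ∫ s in Ioc 0 τ, φ s := by
    intro τ hτ
    have key := hu.integral_inner_eq_add_setIntegral hT hfm hf₂ hΨ hΨdiv hτ
    have hae : ∀ᵐ s ∂(volume.restrict (Ioc 0 τ)),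
        ∫ x, (⟪u s x, Literature.Analysis.FunctionSpaces.Torus.convect (u s) Ψ x⟫ +
          ν * ⟪u s x, Literature.Analysis.FunctionSpaces.Torus.laplacian Ψ x⟫ +
          ⟪(0 : ℝ → UnitAddTorus d → EuclideanSpace ℝ d) s x, Ψ x⟫) = -(ν * lam) * φ s := by
      have h1 : ∀ᵐ s ∂(volume.restrict (Ioo 0 τ)), _ :=
        ae_restrict_of_ae_restrict_of_subset (Ioo_subset_Ioo le_rfl hτ.2) hflux
      exact (ae_restrict_congr_set Ioo_ae_eq_Ioc).1 h1
    rw [integral_congr_ae hae, integral_const_mul] at key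
    rw [hφ]
    simp only at key ⊢
    linarith [key]
  have hint : IntegrableOn φ (Ioo 0 T) := hu.integrableOn_integral_inner hΨ.continuous
  have := eq_mul_exp_of_forall_eq_sub_mul_setIntegral hint hvolterra t ht
  change φ t = _
  rw [this, mul_comm, mul_assoc]

end LinearMode

/-! ## The first component of a shear-form Leray–Hopf solution is the heat flow of `v₁` -/

section Shear

open Literature.Analysis.FunctionSpaces Literature.Analysis.FunctionSpaces.Torus in
/-- **The axial one-mode test fields are divergence free**: for a frequency `k ∈ ℤ³` with
`k₀ = 0` and `w ∈ ℂ`, the real vector mode `Re (e_k(x) w) ê₀` is divergence free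
(`k · (w ê₀) = k₀ w = 0`). [folklore] -/
theorem isDivFree_realTrigPoly_single_zero {k : Fin 3 → ℤ} (hk : k 0 = 0) (w : ℂ) :
    IsDivFree (realTrigPoly {k} (fun _ => EuclideanSpace.single (0 : Fin 3) w)) :=
  isDivFree_realTrigPoly_singleton (by simp [hk])

open Literature.Analysis.FunctionSpaces Literature.Analysis.FunctionSpaces.Torus in
/-- A real vector mode whose coefficient at its own frequency vanishes is zero. [folklore] -/
theorem realTrigPoly_singleton_eq_zero_of_apply {k : Fin 3 → ℤ}
    {c : (Fin 3 → ℤ) → EuclideanSpace ℂ (Fin 3)} (hc : c k = 0) (x : UnitAddTorus (Fin 3)) :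
    realTrigPoly {k} c x = 0 := by
  rw [realTrigPoly_singleton_apply, hc, smul_zero, map_zero]

open Literature.Analysis.FunctionSpaces Literature.Analysis.FunctionSpaces.Torus in
/-- **The convective derivative of an axial mode along a shear-form field vanishes
identically**: for `U = (a(x₂), 0, c(x₁,x₂))` and `Ψ = Re (e_k w) ê₀` with `k₀ = k₂ = 0`
(so `Ψ` depends on `x₂` only — paper coordinates `x₁,x₂,x₃` ↦ indices `0,1,2`),
`(U·∇)Ψ = U₀ ∂₀Ψ + U₁ ∂₁Ψ + U₂ ∂₂Ψ = 0` since `∂₀Ψ = ∂₂Ψ = 0` and `U₁ = 0`. This is why the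
first equation of the two-and-a-half-dimensional system is the *linear* heat equation
(Bardos–Titi–Wiedemann 2012, proof of Thm. 5). [cite: BardosTitiWiedemann2012, Thm. 5, proof] -/
theorem convect_shearField_realTrigPoly_eq_zero (a : ℝ → UnitAddCircle → ℝ) (c : ℝ → UnitAddTorus (Fin 2) → ℝ)
    {k : Fin 3 → ℤ} (hk0 : k 0 = 0) (hk2 : k 2 = 0) (w : ℂ) (t : ℝ) (x : UnitAddTorus (Fin 3)) :
    convect (shearField a c t) (realTrigPoly {k} (fun _ => EuclideanSpace.single (0 : Fin 3) w)) x = 0 := by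
  have h1 : IsContDiff 1 (realTrigPoly {k} (fun _ => EuclideanSpace.single (0 : Fin 3) w)) :=
    (isSmooth_realTrigPoly _ _).isContDiff (by simp)
  rw [convect, fderiv_apply_eq_sum_partialDeriv h1, Fin.sum_univ_three]
  simp only [partialDeriv_realTrigPoly']
  have e0 : realTrigPoly {k} (fun k' : Fin 3 → ℤ =>
      (2 * Real.pi * Complex.I * (k' 0 : ℂ)) • EuclideanSpace.single (0 : Fin 3) w) x = 0 :=
    realTrigPoly_singleton_eq_zero_of_apply (by simp [hk0]) x
  have e2 : realTrigPoly {k} (fun k' : Fin 3 → ℤ =>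
      (2 * Real.pi * Complex.I * (k' 2 : ℂ)) • EuclideanSpace.single (0 : Fin 3) w) x = 0 :=
    realTrigPoly_singleton_eq_zero_of_apply (by simp [hk2]) x
  have e1 : shearField a c t x 1 = 0 := (shearField_apply a c t x).2.1
  rw [e0, e2, e1, smul_zero, zero_smul, smul_zero, add_zero, add_zero]

open Literature.Analysis.FunctionSpaces Literature.Analysis.FunctionSpaces.Torus in
/-- **Pairing a field with an axial mode reads off a Fourier coefficient of its first
component**: for integrable `W : T³ → ℝ³`, `∫ ⟪W, Re (e_k w) ê₀⟫ = Re (w · conj 𝓕(W₀)(k))`. [folklore] -/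
theorem integral_inner_realTrigPoly_single_zero {W : UnitAddTorus (Fin 3) → EuclideanSpace ℝ (Fin 3)} (hW : Integrable W volume)
    (k : Fin 3 → ℤ) (w : ℂ) :
    ∫ x, ⟪W x, realTrigPoly {k} (fun _ => EuclideanSpace.single (0 : Fin 3) w) x⟫ =
      (w * starRingEnd ℂ (mFourierCoeff (fun x => ((W x 0 : ℝ) : ℂ)) k)).re := by
  have hint : Integrable (⇑EuclideanSpace.complexify ∘ W) volume :=
    EuclideanSpace.complexify.toContinuousLinearMap.integrable_comp hW
  have e : mFourierCoeff (⇑EuclideanSpace.complexify ∘ W) k 0 =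
      mFourierCoeff (fun x => ((W x 0 : ℝ) : ℂ)) k := by
    rw [mFourierCoeff_apply_euclidean hint k 0]
    simp only [Function.comp_apply, EuclideanSpace.complexify_apply]
  rw [integral_inner_realTrigPoly_singleton hW, EuclideanSpace.inner_single_right, e]

open Literature.Analysis.FunctionSpaces Literature.Analysis.FunctionSpaces.Torus in
/-- A complex number is determined by the real parts of its conjugate against `1` and `i`. [folklore] -/
theorem complex_eq_of_re_mul_conj_eq {A B : ℂ} {E : ℝ}
    (h1 : ((1 : ℂ) * starRingEnd ℂ A).re = E * ((1 : ℂ) * starRingEnd ℂ B).re)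
    (hI : (Complex.I * starRingEnd ℂ A).re = E * (Complex.I * starRingEnd ℂ B).re) :
    A = (E : ℂ) * B := by
  apply Complex.ext
  · simpa using h1
  · simp at hI
    simp [hI]



open Literature.Analysis.FunctionSpaces Literature.Analysis.FunctionSpaces.Torus in
/-- **The first component of a shear-form Leray–Hopf solution is the heat flow of `v₁`,
modewise.** Let `U = (a(t,x₂), 0, c(t,x₁,x₂))` be a Leray–Hopf weak solution on `T³ × [0,T)`
with viscosity `ν` and shear datum `(v₁(x₂), 0, v₃(x₁,x₂))`. Then for every `t ∈ (0,T]` and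
every frequency `k ∈ ℤ³`, the Fourier coefficients of `x ↦ a(t,x₂)` on `T³` are those of the
heat flow: `𝓕(a(t,·))(k) = e^{-4π²|k|²νt} 𝓕(v₁)(k)` ("the first equation is simply the
one-dimensional heat equation with initial data `v₁(x₂)`", Bardos–Titi–Wiedemann 2012, proof of
Thm. 5). For `k₀ = k₂ = 0` this is `lerayHopf_integral_inner_eq_exp_mul` with the axial modes
`Re (e_k w) ê₀`, `w = 1, i` (divergence free, `Δ`-eigenfunctions, convectively orthogonal by
`convect_shearField_realTrigPoly_eq_zero`); for the other `k` both sides vanish, the functions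
not depending on `x₁, x₃` (`Torus.mFourierCoeff_eq_zero_of_forall_add_single`). [cite: BardosTitiWiedemann2012, Thm. 5, proof] -/
theorem mFourierCoeff_shear_first_eq {v₁ : UnitAddCircle → ℝ} (hv₁ : MemLp v₁ 2 volume)
    {v₃ : UnitAddTorus (Fin 2) → ℝ} (hv₃ : MemLp v₃ 2 volume) {T ν : ℝ} (hT : 0 < T)
    {a : ℝ → UnitAddCircle → ℝ} {c : ℝ → UnitAddTorus (Fin 2) → ℝ}
    (hU : Literature.Analysis.FluidPDE.Torus.IsLerayHopfOn T ν 0 (shearData v₁ v₃) (shearField a c))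
    {t : ℝ} (ht : t ∈ Ioc 0 T) (k : Fin 3 → ℤ) :
    mFourierCoeff (fun x : UnitAddTorus (Fin 3) => ((a t (x 1) : ℝ) : ℂ)) k =
      (Real.exp (-(ν * (4 * Real.pi ^ 2 * freqNormSq k) * t)) : ℂ) *
        mFourierCoeff (fun x : UnitAddTorus (Fin 3) => ((v₁ (x 1) : ℝ) : ℂ)) k := by
  by_cases hk : k 0 = 0 ∧ k 2 = 0
  · -- axial frequencies: the linear mode argument
    have hmode : ∀ w : ℂ,
        (w * starRingEnd ℂ (mFourierCoeff (fun x : UnitAddTorus (Fin 3) => ((a t (x 1) : ℝ) : ℂ)) k)).re =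
          Real.exp (-(ν * (4 * Real.pi ^ 2 * freqNormSq k) * t)) *
            (w * starRingEnd ℂ (mFourierCoeff (fun x : UnitAddTorus (Fin 3) => ((v₁ (x 1) : ℝ) : ℂ)) k)).re := by
      intro w
      set Ψ : UnitAddTorus (Fin 3) → EuclideanSpace ℝ (Fin 3) := realTrigPoly {k} (fun _ => EuclideanSpace.single (0 : Fin 3) w) with hΨ
      have hΨs : IsSmooth Ψ := isSmooth_realTrigPoly _ _
      have hΨdiv : IsDivFree Ψ := isDivFree_realTrigPoly_single_zero hk.1 w
      have hΔ : ∀ x, laplacian Ψ x = (-(4 * Real.pi ^ 2 * freqNormSq k)) • Ψ x := fun x =>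
        laplacian_realTrigPoly_singleton k _ x
      have horth : ∀ᵐ s ∂(volume.restrict (Ioo 0 T)),
          ∫ x, ⟪shearField a c s x, convect (shearField a c s) Ψ x⟫ = 0 :=
        ae_of_all _ fun s => by
          simp_rw [hΨ, convect_shearField_realTrigPoly_eq_zero a c hk.1 hk.2 w s, inner_zero_right,
            integral_zero]
      have key := lerayHopf_integral_inner_eq_exp_mul hT hU hΨs hΨdiv hΔ horth ht
      have hUt : Integrable (shearField a c t) volume :=
        (hU.memLp t ⟨ht.1.le, ht.2⟩).integrable one_le_two
      have hU0 : Integrable (shearData v₁ v₃) volume := (memLp_shearData hv₁ hv₃).integrable one_le_two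
      rw [hΨ, integral_inner_realTrigPoly_single_zero hUt, integral_inner_realTrigPoly_single_zero hU0] at key
      have eA : (fun x : UnitAddTorus (Fin 3) => ((shearField a c t x 0 : ℝ) : ℂ)) = fun x => ((a t (x 1) : ℝ) : ℂ) := by
        funext x; rw [(shearField_apply a c t x).1]
      have eV : (fun x : UnitAddTorus (Fin 3) => ((shearData v₁ v₃ x 0 : ℝ) : ℂ)) = fun x => ((v₁ (x 1) : ℝ) : ℂ) := by
        funext x; rw [(shearData_apply v₁ v₃ x).1]
      rw [eA, eV] at key
      exact key
    exact complex_eq_of_re_mul_conj_eq (hmode 1) (hmode Complex.I)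
  · -- off-axis frequencies: both sides vanish
    rw [not_and_or] at hk
    have hz : ∀ f : UnitAddCircle → ℝ, mFourierCoeff (fun x : UnitAddTorus (Fin 3) => ((f (x 1) : ℝ) : ℂ)) k = 0 := by
      intro f
      rcases hk with h0 | h2
      · exact mFourierCoeff_eq_zero_of_forall_add_single (i := 0) (fun s x => by simp) h0
      · exact mFourierCoeff_eq_zero_of_forall_add_single (i := 2) (fun s x => by simp) h2
    rw [hz (a t), hz v₁, mul_zero]

open Literature.Analysis.FunctionSpaces Literature.Analysis.FunctionSpaces.Torus in
/-- **Parseval for the heat-flow defect.** With `U = (a, 0, c)` a Leray–Hopf solution with shear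
datum as in `mFourierCoeff_shear_first_eq`, for every `t ∈ (0,T]`:
`∫_{T³} |a(t,x₂) - v₁(x₂)|² dx = ∑_{k ∈ ℤ³} (1 - e^{-4π²|k|²νt})² |𝓕v₁(k)|²` (Parseval on `T³`,
Grafakos 2014, Prop. 3.2.7 (3), for the `L²` function `a(t,·) - v₁`, whose coefficients are
`(e^{-4π²|k|²νt} - 1) 𝓕v₁(k)`). [folklore] -/
theorem hasSum_sq_heatDefect {v₁ : UnitAddCircle → ℝ} (hv₁ : MemLp v₁ 2 volume)
    {v₃ : UnitAddTorus (Fin 2) → ℝ} (hv₃ : MemLp v₃ 2 volume) {T ν : ℝ} (hT : 0 < T)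
    {a : ℝ → UnitAddCircle → ℝ} {c : ℝ → UnitAddTorus (Fin 2) → ℝ}
    (hU : Literature.Analysis.FluidPDE.Torus.IsLerayHopfOn T ν 0 (shearData v₁ v₃) (shearField a c))
    {t : ℝ} (ht : t ∈ Ioc 0 T) :
    HasSum (fun k : Fin 3 → ℤ =>
        (1 - Real.exp (-(ν * (4 * Real.pi ^ 2 * freqNormSq k) * t))) ^ 2 *
          ‖mFourierCoeff (fun x : UnitAddTorus (Fin 3) => ((v₁ (x 1) : ℝ) : ℂ)) k‖ ^ 2)
      (∫ x : UnitAddTorus (Fin 3), (a t (x 1) - v₁ (x 1)) ^ 2) := by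
  have hA : MemLp (fun x : UnitAddTorus (Fin 3) => a t (x 1)) 2 volume := by
    have h := (hU.memLp t ⟨ht.1.le, ht.2⟩).eval_piLp 0
    simp_rw [(shearField_apply a c t _).1] at h
    exact h
  have hV : MemLp (fun x : UnitAddTorus (Fin 3) => v₁ (x 1)) 2 volume :=
    hv₁.comp_measurePreserving measurePreserving_eval_one
  have hθ : MemLp (fun x : UnitAddTorus (Fin 3) => a t (x 1) - v₁ (x 1)) 2 volume := hA.sub hV
  have hP := hasSum_sq_norm_mFourierCoeff_ofReal hθ
  have hcoef : ∀ k : Fin 3 → ℤ,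
      mFourierCoeff (fun x : UnitAddTorus (Fin 3) => (((a t (x 1) - v₁ (x 1) : ℝ)) : ℂ)) k =
        ((Real.exp (-(ν * (4 * Real.pi ^ 2 * freqNormSq k) * t)) : ℂ) - 1) *
          mFourierCoeff (fun x : UnitAddTorus (Fin 3) => ((v₁ (x 1) : ℝ) : ℂ)) k := by
    intro k
    have e : (fun x : UnitAddTorus (Fin 3) => (((a t (x 1) - v₁ (x 1) : ℝ)) : ℂ)) =
        (fun x : UnitAddTorus (Fin 3) => ((a t (x 1) : ℝ) : ℂ)) - fun x : UnitAddTorus (Fin 3) => ((v₁ (x 1) : ℝ) : ℂ) := by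
      funext x; simp
    rw [e, mFourierCoeff_sub (hA.integrable one_le_two).ofReal (hV.integrable one_le_two).ofReal,
      mFourierCoeff_shear_first_eq hv₁ hv₃ hT hU ht k]
    ring
  convert hP using 1
  funext k
  rw [hcoef k, norm_mul, mul_pow]
  congr 1
  rw [← Complex.ofReal_one, ← Complex.ofReal_sub, Complex.norm_real, Real.norm_eq_abs, sq_abs]
  ring

/-- `(1 - e^{-x})²` is monotone on `x ≥ 0` and bounded by `1`. [folklore] -/
theorem sq_one_sub_exp_neg_le {x y : ℝ} (hx : 0 ≤ x) (hxy : x ≤ y) :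
    (1 - Real.exp (-x)) ^ 2 ≤ (1 - Real.exp (-y)) ^ 2 := by
  have h0 : 0 ≤ 1 - Real.exp (-x) := by
    rw [sub_nonneg]; exact Real.exp_le_one_iff.2 (by linarith)
  have h1 : 1 - Real.exp (-x) ≤ 1 - Real.exp (-y) := by
    have := Real.exp_le_exp.2 (neg_le_neg hxy); linarith
  exact pow_le_pow_left₀ h0 h1 2

/-- `(1 - e^{-x})² ≤ 1` for `x ≥ 0`. [folklore] -/
theorem sq_one_sub_exp_neg_le_one {x : ℝ} (hx : 0 ≤ x) : (1 - Real.exp (-x)) ^ 2 ≤ 1 := by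
  have h0 : 0 ≤ 1 - Real.exp (-x) := by
    rw [sub_nonneg]; exact Real.exp_le_one_iff.2 (by linarith)
  have h1 : 1 - Real.exp (-x) ≤ 1 := by linarith [Real.exp_pos (-x)]
  calc (1 - Real.exp (-x)) ^ 2 ≤ 1 ^ 2 := pow_le_pow_left₀ h0 h1 2
    _ = 1 := one_pow 2

open Literature.Analysis.FunctionSpaces Literature.Analysis.FunctionSpaces.Torus in
/-- **The vanishing-viscosity limit of the heat-flow defect series**: for `v₁ ∈ L²(T)` and
`ν_j → 0`, `∑_k (1 - e^{-4π²|k|²ν_jT})² |𝓕v₁(k)|² → 0` (dominated convergence on `ℓ¹`,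
Tannery's theorem: each term tends to `0` and is dominated by the summable `|𝓕v₁(k)|²`). [folklore] -/
theorem tendsto_tsum_heatDefect {v₁ : UnitAddCircle → ℝ} (hv₁ : MemLp v₁ 2 volume) (T : ℝ)
    {ν : ℕ → ℝ} (hν : ∀ j, 0 < ν j) (hν₀ : Tendsto ν atTop (𝓝 0)) :
    Tendsto (fun j => ∑' k : Fin 3 → ℤ,
        (1 - Real.exp (-(ν j * (4 * Real.pi ^ 2 * freqNormSq k) * |T|))) ^ 2 *
          ‖mFourierCoeff (fun x : UnitAddTorus (Fin 3) => ((v₁ (x 1) : ℝ) : ℂ)) k‖ ^ 2) atTop (𝓝 0) := by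
  have hV : MemLp (fun x : UnitAddTorus (Fin 3) => v₁ (x 1)) 2 volume :=
    hv₁.comp_measurePreserving measurePreserving_eval_one
  have hsum : Summable fun k : Fin 3 → ℤ => ‖mFourierCoeff (fun x : UnitAddTorus (Fin 3) => ((v₁ (x 1) : ℝ) : ℂ)) k‖ ^ 2 :=
    (hasSum_sq_norm_mFourierCoeff_ofReal hV).summable
  have hlim : ∀ k : Fin 3 → ℤ, Tendsto (fun j =>
      (1 - Real.exp (-(ν j * (4 * Real.pi ^ 2 * freqNormSq k) * |T|))) ^ 2 *
        ‖mFourierCoeff (fun x : UnitAddTorus (Fin 3) => ((v₁ (x 1) : ℝ) : ℂ)) k‖ ^ 2) atTop (𝓝 0) := by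
    intro k
    have h1 : Tendsto (fun j => ν j * (4 * Real.pi ^ 2 * freqNormSq k) * |T|) atTop (𝓝 0) := by
      simpa using (hν₀.mul_const (4 * Real.pi ^ 2 * freqNormSq k)).mul_const |T|
    have h2 : Tendsto (fun j => (1 - Real.exp (-(ν j * (4 * Real.pi ^ 2 * freqNormSq k) * |T|))) ^ 2)
        atTop (𝓝 ((1 - Real.exp (-0)) ^ 2)) :=
      ((Real.continuous_exp.tendsto _).comp h1.neg).const_sub 1 |>.pow 2
    simpa using h2.mul_const (‖mFourierCoeff (fun x : UnitAddTorus (Fin 3) => ((v₁ (x 1) : ℝ) : ℂ)) k‖ ^ 2)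
  have h := tendsto_tsum_of_dominated_convergence (𝓕 := atTop) (g := fun _ => (0 : ℝ)) hsum hlim
    (Eventually.of_forall fun j k => ?_)
  · simpa using h
  · rw [Real.norm_eq_abs, abs_of_nonneg (mul_nonneg (sq_nonneg _) (sq_nonneg _))]
    refine mul_le_of_le_one_left (sq_nonneg _) (sq_one_sub_exp_neg_le_one ?_)
    exact mul_nonneg (mul_nonneg (hν j).le (mul_nonneg (by positivity) (freqNormSq_nonneg k)))
      (abs_nonneg T)

/-- For a real `L²` function, `∫⁻ ‖θ‖ₑ² = ofReal (∫ θ²)`. [folklore] -/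
theorem lintegral_enorm_sq_eq_ofReal_integral_sq_of_memLp {α : Type*} [MeasurableSpace α] {μ : Measure α}
    {θ : α → ℝ} (hθ : MemLp θ 2 μ) : ∫⁻ x, ‖θ x‖ₑ ^ 2 ∂μ = ENNReal.ofReal (∫ x, θ x ^ 2 ∂μ) := by
  have hint : Integrable (fun x => θ x ^ 2) μ := by
    simpa using hθ.integrable_norm_pow two_ne_zero
  rw [ofReal_integral_eq_lintegral_ofReal hint (Eventually.of_forall fun _ => sq_nonneg _)]
  refine lintegral_congr fun x => ?_
  rw [← sq_abs, ENNReal.ofReal_pow (abs_nonneg _), ← Real.enorm_eq_ofReal_abs]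

open Literature.Analysis.FunctionSpaces Literature.Analysis.FunctionSpaces.Torus in
/-- **Bardos–Titi–Wiedemann 2012, Thm. 5, proof: the heat-flow limit of the first component —
discharge of the named fact `BardosTitiWiedemann2012_thm5_heatLimit`.** For Leray–Hopf
solutions `u_j = (a_j(t,x₂), 0, c_j(t,x₁,x₂))` on `T³ × [0,T)` with shear datum
`(v₁(x₂), 0, v₃(x₁,x₂))`, `v₁ ∈ L²(T)`, `v₃ ∈ L²(T²)`, and viscosities `ν_j → 0`, the first
components converge to `v₁` strongly in `L²((0,T) × T³)`: "the first equation is simply the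
one-dimensional heat equation with initial data `v₁(x₂)`, whose solution obviously converges to
the time-independent function `v₁(x₂)` strongly in `L²(T×[0,T])`, as the viscosity tends to
zero" (op. cit.). Proof: `a_j(t,·)` has the Fourier coefficients of the heat flow
(`mFourierCoeff_shear_first_eq`), so by Parseval
`∫|a_j(t) - v₁|² = ∑_k (1 - e^{-4π²|k|²ν_jt})² |𝓕v₁(k)|² ≤ ∑_k (1 - e^{-4π²|k|²ν_jT})² |𝓕v₁(k)|²`
for every `t ∈ (0,T]` (`hasSum_sq_heatDefect`), whence
`∫₀ᵀ∫|a_j - v₁|² ≤ T ∑_k (1 - e^{-4π²|k|²ν_jT})² |𝓕v₁(k)|² → 0` (`tendsto_tsum_heatDefect`). [cite: BardosTitiWiedemann2012, Thm. 5, proof] -/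
theorem BardosTitiWiedemann2012_thm5_heatLimit_holds : BardosTitiWiedemann2012_thm5_heatLimit := by
  intro v₁ hv₁ v₃ hv₃ T hT ν hν hν₀ a c hU
  -- the dominating series
  set S : ℕ → ℝ := fun j => ∑' k : Fin 3 → ℤ,
    (1 - Real.exp (-(ν j * (4 * Real.pi ^ 2 * freqNormSq k) * |T|))) ^ 2 *
      ‖mFourierCoeff (fun x : UnitAddTorus (Fin 3) => ((v₁ (x 1) : ℝ) : ℂ)) k‖ ^ 2 with hS
  have hV : MemLp (fun x : UnitAddTorus (Fin 3) => v₁ (x 1)) 2 volume :=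
    hv₁.comp_measurePreserving measurePreserving_eval_one
  have hsumV : Summable fun k : Fin 3 → ℤ => ‖mFourierCoeff (fun x : UnitAddTorus (Fin 3) => ((v₁ (x 1) : ℝ) : ℂ)) k‖ ^ 2 :=
    (hasSum_sq_norm_mFourierCoeff_ofReal hV).summable
  have hSsum : ∀ j, Summable fun k : Fin 3 → ℤ =>
      (1 - Real.exp (-(ν j * (4 * Real.pi ^ 2 * freqNormSq k) * |T|))) ^ 2 *
        ‖mFourierCoeff (fun x : UnitAddTorus (Fin 3) => ((v₁ (x 1) : ℝ) : ℂ)) k‖ ^ 2 := by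
    intro j
    refine hsumV.of_nonneg_of_le (fun k => mul_nonneg (sq_nonneg _) (sq_nonneg _)) fun k => ?_
    refine mul_le_of_le_one_left (sq_nonneg _) (sq_one_sub_exp_neg_le_one ?_)
    exact mul_nonneg (mul_nonneg (hν j).le (mul_nonneg (by positivity) (freqNormSq_nonneg k)))
      (abs_nonneg T)
  -- the slice bound
  have hslice : ∀ j, ∀ t ∈ Ioo 0 T,
      ∫⁻ x : UnitAddTorus (Fin 3), ‖a j t (x 1) - v₁ (x 1)‖ₑ ^ 2 ≤ ENNReal.ofReal (S j) := by
    intro j t ht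
    have ht' : t ∈ Ioc 0 T := ⟨ht.1, ht.2.le⟩
    have hA : MemLp (fun x : UnitAddTorus (Fin 3) => a j t (x 1)) 2 volume := by
      have h := ((hU j).memLp t ⟨ht.1.le, ht.2.le⟩).eval_piLp 0
      simp_rw [(shearField_apply (a j) (c j) t _).1] at h
      exact h
    have hθ : MemLp (fun x : UnitAddTorus (Fin 3) => a j t (x 1) - v₁ (x 1)) 2 volume := hA.sub hV
    rw [lintegral_enorm_sq_eq_ofReal_integral_sq_of_memLp hθ]
    refine ENNReal.ofReal_le_ofReal ?_
    refine hasSum_le (fun k => ?_) (hasSum_sq_heatDefect hv₁ hv₃ hT (hU j) ht') (hSsum j).hasSum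
    refine mul_le_mul_of_nonneg_right (sq_one_sub_exp_neg_le ?_ ?_) (sq_nonneg _)
    · exact mul_nonneg (mul_nonneg (hν j).le (mul_nonneg (by positivity) (freqNormSq_nonneg k)))
        ht.1.le
    · rw [abs_of_pos hT]
      exact mul_le_mul_of_nonneg_left ht.2.le
        (mul_nonneg (hν j).le (mul_nonneg (by positivity) (freqNormSq_nonneg k)))
  -- integrate the slice bound over `(0,T)`
  have hle : ∀ j, ∫⁻ t in Ioo 0 T, ∫⁻ x : UnitAddTorus (Fin 3), ‖a j t (x 1) - v₁ (x 1)‖ₑ ^ 2 ≤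
      ENNReal.ofReal (S j) * ENNReal.ofReal T := by
    intro j
    calc ∫⁻ t in Ioo 0 T, ∫⁻ x : UnitAddTorus (Fin 3), ‖a j t (x 1) - v₁ (x 1)‖ₑ ^ 2
        ≤ ∫⁻ _ in Ioo (0 : ℝ) T, ENNReal.ofReal (S j) := setLIntegral_mono measurable_const (hslice j)
      _ = ENNReal.ofReal (S j) * ENNReal.ofReal T := by
          rw [lintegral_const, Measure.restrict_apply_univ, Real.volume_Ioo, sub_zero]
  have hlim : Tendsto (fun j => ENNReal.ofReal (S j) * ENNReal.ofReal T) atTop (𝓝 0) := by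
    have h1 : Tendsto (fun j => ENNReal.ofReal (S j)) atTop (𝓝 (ENNReal.ofReal 0)) :=
      ENNReal.tendsto_ofReal (tendsto_tsum_heatDefect hv₁ T hν hν₀)
    rw [ENNReal.ofReal_zero] at h1
    have := ENNReal.Tendsto.mul_const (b := ENNReal.ofReal T) h1 (Or.inr ENNReal.ofReal_ne_top)
    rwa [zero_mul] at this
  exact tendsto_of_tendsto_of_tendsto_of_le_of_le tendsto_const_nhds hlim (fun _ => zero_le) hle

end Shear

end Literature.Barriers.AnomalousDissipation

end
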